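import Mathlib
import HarnessLib
import Summits.NavierStokesRegularity.NavierStokesRegularity.Theorems.HalfSpaceWindowDoorCirculationCarryingRigidityGaussSubExtremal
import Summits.NavierStokesRegularity.NavierStokesRegularity.Theorems.HalfSpaceWindowDoorCirculationCarryingRigidityGaussExtremalTilting
import Summits.NavierStokesRegularity.NavierStokesRegularity.Theorems.HalfSpaceWindowDoorCirculationCarryingRigidityGaussExtremalConditions

/-!
# Route `HalfSpaceWindowDoor`, crux `CirculationCarryingRigidity` (stmt-NavierStokesRegularity-25311) —
# census rows about the SINGULAR AXIS in the SPACE–TIME Type-I class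

LEAD ns-hsw-p1 g9 (cell pub-ns-dss), `--supports stmt-NavierStokesRegularity-25311 --as helper`; line `blowdown` / `gauss_swirl`
(cards `Cruxes/CirculationCarryingRigidity/Lines/blowdown.md`, `…/gauss_swirl.md`).

The tilting window of the blowdown line (`(2 − 2C)M₀ ≤ 𝒯 ≤ (2 + 2C)M₀`, `…GaussExtremalTiltingSharp`) lives at the UNKNOWN Gaussian-
extremal axis and costs the axis-maximality (horizontal Hessian moment `≤ 4M₀`) to bound the radial-inflow moment `𝒜 = ∫G(x_h·v_h)ω₃`
by `2C·M₀`.  In the SPACE–TIME Type-I sub-class `‖v(t,x)‖ ≤ D/(‖x‖ + √(−t))` (`HasTypeIDecay D v`, KNSS (1.6); the class of the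
tree's `…TiltDominatedLiouville`) the product `‖x‖·‖v(t,x)‖ ≤ D` is bounded OUTRIGHT about the singular axis `x = 0`, so
`|x_h·v_h| ≤ D` pointwise and `𝒜_t(s) ≥ −D·M_t(s)` (`M_t(s) = ∫G_t ω₃(s)`) at EVERY time and scale with NO extremality
(`radialInflowMoment_ge`).  Through the kinematic inflow identity O1b (`ℐ = (4π)^{3/2}·2t·(𝒜_t − 𝒯_t)`) and `𝒢 = (4π)^{3/2}·2t·M_t`
this reads `ℐ ≥ −D·𝒢 − (4π)^{3/2}·2t·𝒯_t` about the singular axis (`gaussInflow_ge_singularAxis`), and the sub-extremal census row R_κ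
(`…GaussSubExtremal.poloidal_of_subExtremalInflow`, `κ < 2`) gives:

* `poloidal_of_singularAxis_tilting_le` — space–time class + closed hemisphere + along ONE characteristic family with apex `s₀` about the
  SINGULAR axis, before some epoch, Gaussian tilting moment `𝒯_{s₀−s}(s) ≤ θ·M_{s₀−s}(s)` with `D + θ < 2` ⇒ poloidal;
* `poloidal_of_singularAxis_antiTilting` — in particular `D < 2` and ANTI-TILTING `𝒯 ≤ 0` about the singular axis before an epoch
  (horizontal vorticity points inward where the fluid rises / outward where it sinks, in Gaussian mean) ⇒ poloidal;
* `enemy_singularAxis_tilting` — census reading: a circulation-carrying closed-hemisphere space–time-Type-I profile with `D < 2` TILTS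
  POSITIVELY ABOUT ITS OWN SINGULAR AXIS, `𝒯_{s₀−s}(s) > θ·M_{s₀−s}(s)` for every `θ < 2 − D`, every apex `s₀`, at arbitrarily early times.

Compare `…EddyTiltTorque` (axis-Type-I + circle-wise one-sided tilt-torque bound, any `D`) and the extremal-axis window (time-only class,
`C < 1`): here ONE Gaussian-mean hypothesis per time about the blow-up axis itself, threshold `D < 2`, no normal form.
WHAT THIS IS NOT: not a statement about Navier–Stokes regularity; door statements concern HYPOTHETICAL blow-up profiles (KNSS ancient mild
solutions).  No item is closed by this file.
-/

noncomputable section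

-- the summit and its single sub-problem share the name (CONVENTIONS §1), as in every Theorems file
set_option linter.dupNamespace false

namespace Summit.NavierStokesRegularity.NavierStokesRegularity.Theorems.HalfSpaceWindowDoorCirculationCarryingRigiditySingularAxisTilting

open MeasureTheory Set Function Filter Topology
open scoped RealInnerProductSpace InnerProductSpace
open Literature.Analysis Literature.Analysis.FluidPDE Literature.Analysis.UnboundedOperators
open Summit.NavierStokesRegularity.NavierStokesRegularity.Theses.HalfSpaceWindowDoor
open Summit.NavierStokesRegularity.NavierStokesRegularity.Theorems.HalfSpaceWindowDoorCirculationCarryingRigidityDefs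
open Summit.NavierStokesRegularity.NavierStokesRegularity.Theorems.HalfSpaceWindowDoorCirculationCarryingRigidityGaussKernel
  (inner_e3_apply)
open Summit.NavierStokesRegularity.NavierStokesRegularity.Theorems.HalfSpaceWindowDoorCirculationCarryingRigidityGaussSwirlLaw
  (gaussianInflowIdentity_holds)
open Summit.NavierStokesRegularity.NavierStokesRegularity.Theorems.HalfSpaceWindowDoorCirculationCarryingRigidityGaussExtremalConditions
  (gaussAngMom_eq_heatExtension omega3_continuous_bounded heatKernel_sub_comm)
open Summit.NavierStokesRegularity.NavierStokesRegularity.Theorems.HalfSpaceWindowDoorCirculationCarryingRigidityGaussExtremalTilting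
  (slice_components abs_horiz_dot_le abs_horiz_dot_le_two)
open Summit.NavierStokesRegularity.NavierStokesRegularity.Theorems.HalfSpaceWindowDoorCirculationCarryingRigidityGaussSubExtremal
  (poloidal_of_subExtremalInflow)

variable {D : ℝ}

/-! ### The space–time class sits inside the door class -/

/-- The constant of a space–time Type-I bound is non-negative. -/
theorem nonneg_of_hasTypeIDecay {v : ℝ → EuclideanSpace ℝ (Fin 3) → EuclideanSpace ℝ (Fin 3)} (hdec : HasTypeIDecay D v) :
    0 ≤ D := by
  have h := hdec (-1) (by norm_num) 0
  rw [norm_zero, zero_add, neg_neg, Real.sqrt_one, div_one] at h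
  exact (norm_nonneg _).trans h

/-- A space–time Type-I profile with the three structural hypotheses is in the door class with the same constant. -/
theorem inDoorClass_of_hasTypeIDecay {v : ℝ → EuclideanSpace ℝ (Fin 3) → EuclideanSpace ℝ (Fin 3)} (hdec : HasTypeIDecay D v)
    (hcont : ContinuousOn (Function.uncurry v) (Set.Iio (0 : ℝ) ×ˢ Set.univ))
    (hmild : ∀ s t : ℝ, s < t → t < 0 → ∀ x, v t x = heatExtension (v s) (t - s) x - oseenDuhamel 1 s v v t x)
    (hdiv : ∀ t < 0, VectorCalculus.IsDivFree (v t)) : InDoorClass D v :=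
  ⟨hdec.hasTypeITimeDecay (nonneg_of_hasTypeIDecay hdec), hcont, hmild, hdiv⟩

/-- **About the singular axis `‖x‖·‖v‖ ≤ D`**, hence `|x_h·v_h(s,x)| ≤ D` pointwise at every time. -/
theorem abs_horiz_dot_le_of_hasTypeIDecay {v : ℝ → EuclideanSpace ℝ (Fin 3) → EuclideanSpace ℝ (Fin 3)} (hdec : HasTypeIDecay D v)
    {s : ℝ} (hs : s < 0) (x : EuclideanSpace ℝ (Fin 3)) : |x 0 * v s x 0 + x 1 * v s x 1| ≤ D := by
  have hD := nonneg_of_hasTypeIDecay hdec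
  have h := hdec s hs x
  have hsq : 0 < Real.sqrt (-s) := Real.sqrt_pos.2 (neg_pos.2 hs)
  have hden : 0 < ‖x‖ + Real.sqrt (-s) := by positivity
  have h1 : |x 0 * v s x 0 + x 1 * v s x 1| ≤ ‖x‖ * ‖v s x‖ := abs_horiz_dot_le x (v s x) le_rfl
  have h2 : ‖x‖ * ‖v s x‖ ≤ ‖x‖ * (D / (‖x‖ + Real.sqrt (-s))) := mul_le_mul_of_nonneg_left h (norm_nonneg _)
  have h3 : ‖x‖ * (D / (‖x‖ + Real.sqrt (-s))) ≤ D := by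
    rw [mul_div_assoc', div_le_iff₀ hden]
    nlinarith [norm_nonneg x]
  exact h1.trans (h2.trans h3)

/-! ### The radial-inflow moment floor and the inflow inequality about the singular axis -/

/-- Integrability of the Gaussian radial-inflow and tilting integrands of a door-class slice (bounded continuous factors against the
first Gaussian moment). -/
theorem integrable_moments {v : ℝ → EuclideanSpace ℝ (Fin 3) → EuclideanSpace ℝ (Fin 3)} {C : ℝ} (hv : InDoorClass C v)
    {s : ℝ} (hs : s < 0) {t : ℝ} (ht : 0 < t) :
    Integrable (fun x : EuclideanSpace ℝ (Fin 3) => heatKernel t x * ((x 0 * v s x 0 + x 1 * v s x 1) * curl (v s) x 2)) ∧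
    Integrable (fun x : EuclideanSpace ℝ (Fin 3) => heatKernel t x * ((x 0 * curl (v s) x 0 + x 1 * curl (v s) x 1) * v s x 2)) ∧
    Integrable (fun x : EuclideanSpace ℝ (Fin 3) => heatKernel t x * curl (v s) x 2) := by
  obtain ⟨hvc, hvB, hωc, K, hωK⟩ := slice_components hv hs
  set B : ℝ := C / Real.sqrt (-s) with hB
  have hvC : ∀ x, ‖v s x‖ ≤ B := fun x => hv.1 s hs x
  have hB0 : 0 ≤ B := (norm_nonneg _).trans (hvC 0)
  have hK0 : 0 ≤ K := (abs_nonneg _).trans (hωK 0 0)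
  have hv2 : ∀ x, |v s x 2| ≤ B := fun x => ((Real.norm_eq_abs _).symm.le.trans (PiLp.norm_apply_le (v s x) 2)).trans (hvC x)
  have hcont_yi : ∀ i : Fin 3, Continuous fun y : EuclideanSpace ℝ (Fin 3) => y i := fun i =>
    (continuous_apply i).comp (PiLp.continuous_ofLp 2 _)
  have hGc : Continuous fun y : EuclideanSpace ℝ (Fin 3) => heatKernel t y := by
    unfold heatKernel; fun_prop
  have hmom1 : Integrable (fun y : EuclideanSpace ℝ (Fin 3) => heatKernel t y * ‖y‖) :=
    integrable_heatKernel_mul_norm (E := EuclideanSpace ℝ (Fin 3)) ht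
  refine ⟨?_, ?_, ?_⟩
  · refine Integrable.mono' (hmom1.const_mul (B * K)) ?_ (ae_of_all _ fun y => ?_)
    · exact (hGc.mul ((((hcont_yi 0).mul (hvc 0)).add ((hcont_yi 1).mul (hvc 1))).mul (hωc 2))).aestronglyMeasurable
    · have hG : 0 ≤ heatKernel t y := (heatKernel_pos ht _).le
      rw [Real.norm_eq_abs, abs_mul, abs_of_nonneg hG, abs_mul]
      calc heatKernel t y * (|y 0 * v s y 0 + y 1 * v s y 1| * |curl (v s) y 2|)
          ≤ heatKernel t y * ((‖y‖ * B) * K) :=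
            mul_le_mul_of_nonneg_left (mul_le_mul (abs_horiz_dot_le y (v s y) (hvC y)) (hωK 2 y) (abs_nonneg _) (by positivity)) hG
        _ = B * K * (heatKernel t y * ‖y‖) := by ring
  · refine Integrable.mono' (hmom1.const_mul (2 * K * B)) ?_ (ae_of_all _ fun y => ?_)
    · exact (hGc.mul ((((hcont_yi 0).mul (hωc 0)).add ((hcont_yi 1).mul (hωc 1))).mul (hvc 2))).aestronglyMeasurable
    · have hG : 0 ≤ heatKernel t y := (heatKernel_pos ht _).le
      rw [Real.norm_eq_abs, abs_mul, abs_of_nonneg hG, abs_mul]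
      calc heatKernel t y * (|y 0 * curl (v s) y 0 + y 1 * curl (v s) y 1| * |v s y 2|)
          ≤ heatKernel t y * ((2 * K * ‖y‖) * B) :=
            mul_le_mul_of_nonneg_left (mul_le_mul (abs_horiz_dot_le_two y (curl (v s) y) (fun i => hωK i y)) (hv2 y)
              (abs_nonneg _) (by positivity)) hG
        _ = 2 * K * B * (heatKernel t y * ‖y‖) := by ring
  · obtain ⟨hωc', B', hωB'⟩ := omega3_continuous_bounded hv hs
    have h := ((integrable_heatKernel_holds (E := EuclideanSpace ℝ (Fin 3)) ht).bdd_mul hωc'.aestronglyMeasurable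
      (ae_of_all _ fun x => hωB' x))
    refine h.congr (ae_of_all _ fun x => ?_)
    show ⟪curl (v s) x, e3⟫ * heatKernel t x = heatKernel t x * curl (v s) x 2
    rw [inner_e3_apply, mul_comm]

/-- `𝒢(t;0)[v(s)] = (4π)^{3/2}·2t·∫G_t ω₃(s)` (the Gaussian angular momentum about the origin axis is the Gaussian mass of `ω₃`). -/
theorem gaussAngMom_zero_eq {v : ℝ → EuclideanSpace ℝ (Fin 3) → EuclideanSpace ℝ (Fin 3)} {C : ℝ} (hv : InDoorClass C v)
    {s : ℝ} (hs : s < 0) {t : ℝ} (ht : 0 < t) :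
    gaussAngMom t 0 (v s) = (4 * Real.pi) ^ ((3 : ℝ) / 2) * (2 * t) * ∫ x, heatKernel t x * curl (v s) x 2 := by
  rw [gaussAngMom_eq_heatExtension hv hs ht 0, heatExtension_eq_integral_mul]
  congr 1
  refine integral_congr_ae (ae_of_all _ fun z => ?_)
  show heatKernel t (0 - z) * ⟪curl (v s) z, e3⟫ = heatKernel t z * curl (v s) z 2
  rw [heatKernel_sub_comm, sub_zero, inner_e3_apply]

/-- `ℐ(t;0)[v(s)] = (4π)^{3/2}·2t·(𝒜_t − 𝒯_t)` about the origin axis: the kinematic inflow identity O1b split into the radial-inflow moment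
`𝒜_t = ∫G_t(x_h·v_h)ω₃` and the tilting moment `𝒯_t = ∫G_t(x_h·ω_h)v₃`. -/
theorem gaussInflow_zero_eq {v : ℝ → EuclideanSpace ℝ (Fin 3) → EuclideanSpace ℝ (Fin 3)} {C : ℝ} (hv : InDoorClass C v)
    {s : ℝ} (hs : s < 0) {t : ℝ} (ht : 0 < t) :
    gaussInflow t 0 (v s) = (4 * Real.pi) ^ ((3 : ℝ) / 2) * (2 * t) *
      ((∫ x, heatKernel t x * ((x 0 * v s x 0 + x 1 * v s x 1) * curl (v s) x 2)) -
        ∫ x, heatKernel t x * ((x 0 * curl (v s) x 0 + x 1 * curl (v s) x 1) * v s x 2)) := by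
  obtain ⟨hA, hT, -⟩ := integrable_moments hv hs ht
  rw [gaussianInflowIdentity_holds C v hv 0 t s ht hs, ← integral_sub hA hT]
  congr 1
  refine integral_congr_ae (ae_of_all _ fun x => ?_)
  show heatKernel t (x - 0) * ((x - 0) 0 * (v s x 0 * curl (v s) x 2 - curl (v s) x 0 * v s x 2) +
      (x - 0) 1 * (v s x 1 * curl (v s) x 2 - curl (v s) x 1 * v s x 2)) =
    heatKernel t x * ((x 0 * v s x 0 + x 1 * v s x 1) * curl (v s) x 2) -
      heatKernel t x * ((x 0 * curl (v s) x 0 + x 1 * curl (v s) x 1) * v s x 2)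
  rw [sub_zero]; ring

/-- **RADIAL-INFLOW MOMENT FLOOR about the singular axis** (space–time class + closed hemisphere, every time `s < 0`, every scale `t > 0`):
`𝒜_t(s) = ∫G_t(x_h·v_h)ω₃ ≥ −D·∫G_t ω₃`. -/
theorem radialInflowMoment_ge {v : ℝ → EuclideanSpace ℝ (Fin 3) → EuclideanSpace ℝ (Fin 3)} (hdec : HasTypeIDecay D v)
    (hv : InDoorClass D v) (hsign : SignE3 v) {s : ℝ} (hs : s < 0) {t : ℝ} (ht : 0 < t) :
    -D * ∫ x, heatKernel t x * curl (v s) x 2 ≤ ∫ x, heatKernel t x * ((x 0 * v s x 0 + x 1 * v s x 1) * curl (v s) x 2) := by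
  obtain ⟨hA, -, h0⟩ := integrable_moments hv hs ht
  rw [← integral_const_mul]
  refine integral_mono (h0.const_mul _) hA fun x => ?_
  have hG : 0 ≤ heatKernel t x := (heatKernel_pos ht _).le
  have hω : 0 ≤ curl (v s) x 2 := by rw [← inner_e3_apply]; exact hsign s hs x
  have hd := (abs_le.1 (abs_horiz_dot_le_of_hasTypeIDecay hdec hs x)).1
  show -D * (heatKernel t x * curl (v s) x 2) ≤ heatKernel t x * ((x 0 * v s x 0 + x 1 * v s x 1) * curl (v s) x 2)
  have := mul_le_mul_of_nonneg_right hd (mul_nonneg hG hω)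
  nlinarith

/-- **INFLOW INEQUALITY about the singular axis**: `ℐ(t;0)[v(s)] ≥ −D·𝒢(t;0)[v(s)] − (4π)^{3/2}·2t·𝒯_t(s)`. -/
theorem gaussInflow_ge_singularAxis {v : ℝ → EuclideanSpace ℝ (Fin 3) → EuclideanSpace ℝ (Fin 3)} (hdec : HasTypeIDecay D v)
    (hv : InDoorClass D v) (hsign : SignE3 v) {s : ℝ} (hs : s < 0) {t : ℝ} (ht : 0 < t) :
    -D * gaussAngMom t 0 (v s) -
        (4 * Real.pi) ^ ((3 : ℝ) / 2) * (2 * t) * ∫ x, heatKernel t x * ((x 0 * curl (v s) x 0 + x 1 * curl (v s) x 1) * v s x 2) ≤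
      gaussInflow t 0 (v s) := by
  rw [gaussInflow_zero_eq hv hs ht, gaussAngMom_zero_eq hv hs ht]
  have hc : 0 < (4 * Real.pi) ^ ((3 : ℝ) / 2) * (2 * t) := by positivity
  have h := radialInflowMoment_ge hdec hv hsign hs ht
  nlinarith

/-! ### The census rows -/

/-- **CENSUS ROW (space–time class): bounded tilting about the SINGULAR axis forces poloidality when `D + θ < 2`.**  Let `v` be a
closed-hemisphere door-class profile obeying the space–time Type-I bound `‖v(t,x)‖ ≤ D/(‖x‖ + √(−t))`.  If along ONE characteristic
family about the singular axis (apex `s₀`, axis point `0`), at all times before some epoch `s₁ < min(0, s₀)`, the Gaussian tilting moment is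
bounded by `θ` Gaussian masses of `ω₃`, `∫G_{s₀−s}(x_h·ω_h)v₃ ≤ θ·∫G_{s₀−s}ω₃`, with `D + θ < 2`, then `⟪curl v, e₃⟫ ≡ 0`. -/
theorem poloidal_of_singularAxis_tilting_le {v : ℝ → EuclideanSpace ℝ (Fin 3) → EuclideanSpace ℝ (Fin 3)} (hdec : HasTypeIDecay D v)
    (hcont : ContinuousOn (Function.uncurry v) (Set.Iio (0 : ℝ) ×ˢ Set.univ))
    (hmild : ∀ s t : ℝ, s < t → t < 0 → ∀ x, v t x = heatExtension (v s) (t - s) x - oseenDuhamel 1 s v v t x)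
    (hdiv : ∀ t < 0, VectorCalculus.IsDivFree (v t)) (hsign : SignE3 v)
    {s₀ s₁ θ : ℝ} (hs₁ : s₁ < 0) (hs₁₀ : s₁ < s₀) (hθ : D + θ < 2)
    (htilt : ∀ s < s₁, ∫ x, heatKernel (s₀ - s) x * ((x 0 * curl (v s) x 0 + x 1 * curl (v s) x 1) * v s x 2) ≤
      θ * ∫ x, heatKernel (s₀ - s) x * curl (v s) x 2) :
    ∀ s < 0, ∀ y, ⟪curl (v s) y, e3⟫ = 0 := by
  have hv : InDoorClass D v := inDoorClass_of_hasTypeIDecay hdec hcont hmild hdiv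
  refine poloidal_of_subExtremalInflow hv hsign (x₀ := 0) (κ := D + θ) hs₁ hs₁₀ hθ fun s hs => ?_
  have hs0 : s < 0 := hs.trans hs₁
  have ht : 0 < s₀ - s := by linarith
  have hc : 0 < (4 * Real.pi) ^ ((3 : ℝ) / 2) * (2 * (s₀ - s)) := by positivity
  have h1 := gaussInflow_ge_singularAxis hdec hv hsign hs0 ht
  have h2 := htilt s hs
  have hG := gaussAngMom_zero_eq hv hs0 ht
  -- `−(D+θ)𝒢 = −D𝒢 − c·θ·M ≤ −D𝒢 − c·𝒯 ≤ ℐ`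
  have h3 : (4 * Real.pi) ^ ((3 : ℝ) / 2) * (2 * (s₀ - s)) *
      ∫ x, heatKernel (s₀ - s) x * ((x 0 * curl (v s) x 0 + x 1 * curl (v s) x 1) * v s x 2) ≤ θ * gaussAngMom (s₀ - s) 0 (v s) := by
    rw [hG]
    have := mul_le_mul_of_nonneg_left h2 hc.le
    linarith
  linarith

/-- **CENSUS ROW: `D < 2` + ANTI-TILTING about the singular axis ⇒ poloidal.**  In the space–time class with `D < 2`, a closed-hemisphere
profile whose Gaussian tilting moment about the singular axis is `≤ 0` along one characteristic family before some epoch is poloidal. -/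
theorem poloidal_of_singularAxis_antiTilting {v : ℝ → EuclideanSpace ℝ (Fin 3) → EuclideanSpace ℝ (Fin 3)} (hdec : HasTypeIDecay D v)
    (hcont : ContinuousOn (Function.uncurry v) (Set.Iio (0 : ℝ) ×ˢ Set.univ))
    (hmild : ∀ s t : ℝ, s < t → t < 0 → ∀ x, v t x = heatExtension (v s) (t - s) x - oseenDuhamel 1 s v v t x)
    (hdiv : ∀ t < 0, VectorCalculus.IsDivFree (v t)) (hsign : SignE3 v) (hD : D < 2)
    {s₀ s₁ : ℝ} (hs₁ : s₁ < 0) (hs₁₀ : s₁ < s₀)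
    (htilt : ∀ s < s₁, ∫ x, heatKernel (s₀ - s) x * ((x 0 * curl (v s) x 0 + x 1 * curl (v s) x 1) * v s x 2) ≤ 0) :
    ∀ s < 0, ∀ y, ⟪curl (v s) y, e3⟫ = 0 :=
  poloidal_of_singularAxis_tilting_le hdec hcont hmild hdiv hsign (θ := 0) hs₁ hs₁₀ (by linarith) fun s hs => by
    rw [zero_mul]; exact htilt s hs

/-- **CENSUS READING — the enemy tilts positively about its own singular axis, infinitely often in the far past.**  A circulation-carrying
(`⟪curl v(σ)(y), e₃⟫ > 0` somewhere) closed-hemisphere space–time-Type-I profile satisfies, for every apex `s₀`, every epoch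
`s₁ < min(0,s₀)` and every `θ` with `D + θ < 2`: at SOME time `s < s₁`, `∫G_{s₀−s}(x_h·ω_h)v₃ > θ·∫G_{s₀−s}ω₃`. -/
theorem enemy_singularAxis_tilting {v : ℝ → EuclideanSpace ℝ (Fin 3) → EuclideanSpace ℝ (Fin 3)} (hdec : HasTypeIDecay D v)
    (hcont : ContinuousOn (Function.uncurry v) (Set.Iio (0 : ℝ) ×ˢ Set.univ))
    (hmild : ∀ s t : ℝ, s < t → t < 0 → ∀ x, v t x = heatExtension (v s) (t - s) x - oseenDuhamel 1 s v v t x)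
    (hdiv : ∀ t < 0, VectorCalculus.IsDivFree (v t)) (hsign : SignE3 v) (hpos : ∃ σ < 0, ∃ y, 0 < ⟪curl (v σ) y, e3⟫)
    {s₀ s₁ θ : ℝ} (hs₁ : s₁ < 0) (hs₁₀ : s₁ < s₀) (hθ : D + θ < 2) :
    ∃ s < s₁, θ * ∫ x, heatKernel (s₀ - s) x * curl (v s) x 2 <
      ∫ x, heatKernel (s₀ - s) x * ((x 0 * curl (v s) x 0 + x 1 * curl (v s) x 1) * v s x 2) := by
  by_contra h
  push Not at h
  obtain ⟨σ, hσ, y, hy⟩ := hpos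
  have h0 := poloidal_of_singularAxis_tilting_le hdec hcont hmild hdiv hsign hs₁ hs₁₀ hθ h σ hσ y
  exact hy.ne' h0

end Summit.NavierStokesRegularity.NavierStokesRegularity.Theorems.HalfSpaceWindowDoorCirculationCarryingRigiditySingularAxisTilting

end
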